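import Summits.Ventures.PercRepro.C041CycleArcModel
import Summits.Ventures.PercRepro.C041TriangleMarksCone

/-!
# EVERY TWO-EXIT CYCLE WHOSE TRIANGLE PART IS IN THE CONE IS IN THE CONE — and the marked-vertex instances
(mine-3, gen 59; C-041.md §21 (r), (u), (z))

By the exact reduction `thetaCyc_eq` the cycle is the triangle plus cone members, so the cycle lies in the cone as soon
as its triangle part does (`InCone_thetaCyc_of_InCone_tri`).  Instances: inputs with a vanishing mixed-type defect
(`InCone_thetaCyc_of_alpha_eq_beta`: single marks, marks of one common type), and the marked-vertex pairs with ≤ 2 marks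
of `C041TriangleMarksCone` (`InCone_thetaCyc_X11_X10`, …, `InCone_thetaCyc_X20_X02`) — so every two-exit cycle through the
anchor carrying two marked vertices with at most two marks each lies in the cone, whatever its length and the positions
of the vertices (on the arc-type model; the dictionary is C-041.md §20 (d)).
-/

namespace PercRepro

namespace RelaxedTriangle

open TreeClosure

/-- **A cycle is in the cone if its triangle part is**: for cone members `w`, `w′` with `θ_△(w, w′) ∈ cone` and
`p, q, s ≥ 0`, `thetaCyc p q s w w′ ∈ cone`. -/
theorem InCone_thetaCyc_of_InCone_tri {w w' : Vec6} (hw : InCone w) (hw' : InCone w')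
    (ht : InCone (thetaTri w w')) {p q s : ℝ} (hp : 0 ≤ p) (hq : 0 ≤ q) (hs : 0 ≤ s) :
    InCone (thetaCyc p q s w w') := by
  rw [thetaCyc_eq]
  have hn : 0 ≤ nAdm w := nAdm_nonneg_of_K4v (K4v_of_InCone hw)
  have hn' : 0 ≤ nAdm w' := nAdm_nonneg_of_K4v (K4v_of_InCone hw')
  have hnn : 0 ≤ nAdm (w * w') := nAdm_nonneg_of_K4v (K4v_of_InCone (hw.mul hw'))
  refine (((ht.add (InCone.smul _ hp (InCone_ellv ((InCone_ellv hw).mul hw')))).add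
    (InCone.smul _ hs (InCone_ellv (hw.mul (InCone_ellv hw'))))).add
    (InCone.smul _ (mul_nonneg (mul_nonneg hp hs) (add_nonneg (mul_nonneg hn hn') hnn)) InCone_one)).add
    (InCone.smul _ hq (((InCone_ellv hw).add (InCone.smul _ (mul_nonneg hp hn) InCone_one)).mul
      ((InCone_ellv hw').add (InCone.smul _ (mul_nonneg hs hn') InCone_one))))

/-- Cycles whose exits carry cone members with a vanishing mixed-type defect (`α = β`) lie in the cone. -/
theorem InCone_thetaCyc_of_alpha_eq_beta {w w' : Vec6} (hw : InCone w) (hw' : InCone w')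
    (hαβ : T1 w * T2 w' + T2 w * T1 w' = I1 w * I2 w' + I2 w * I1 w') {p q s : ℝ} (hp : 0 ≤ p) (hq : 0 ≤ q)
    (hs : 0 ≤ s) : InCone (thetaCyc p q s w w') :=
  InCone_thetaCyc_of_InCone_tri hw hw' (thetaTri_InCone_of_alpha_eq_beta hw hw' hαβ) hp hq hs

/-- Cycles with two vertices carrying marks of type 1 only lie in the cone. -/
theorem InCone_thetaCyc_pow_one (p₁ p₂ : ℕ) {p q s : ℝ} (hp : 0 ≤ p) (hq : 0 ≤ q) (hs : 0 ≤ s) :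
    InCone (thetaCyc p q s (v 1 ^ p₁) (v 1 ^ p₂)) :=
  InCone_thetaCyc_of_InCone_tri (InCone_pow_v_one p₁) (InCone_pow_v_one p₂) (thetaTri_pow_one_InCone p₁ p₂) hp hq hs

/-- Cycles with two vertices carrying marks of type 2 only lie in the cone. -/
theorem InCone_thetaCyc_pow_zero (q₁ q₂ : ℕ) {p q s : ℝ} (hp : 0 ≤ p) (hq : 0 ≤ q) (hs : 0 ≤ s) :
    InCone (thetaCyc p q s (v 0 ^ q₁) (v 0 ^ q₂)) :=
  InCone_thetaCyc_of_InCone_tri (InCone_pow_v_zero q₁) (InCone_pow_v_zero q₂) (thetaTri_pow_zero_InCone q₁ q₂) hp hq hs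

/-- The single marks `v 1`, `v 0` lie in the cone. -/
theorem InCone_v1 : InCone (v 1) := InCone_v 1 ⟨zero_le_one, le_rfl⟩

/-- The single 2-mark lies in the cone. -/
theorem InCone_v0 : InCone (v 0) := InCone_v 0 ⟨le_rfl, zero_le_one⟩

/-- Cycle with the marked vertices `X(1,1)`, `X(1,0)`. -/
theorem InCone_thetaCyc_X11_X10 {p q s : ℝ} (hp : 0 ≤ p) (hq : 0 ≤ q) (hs : 0 ≤ s) :
    InCone (thetaCyc p q s (v 1 * v 0) (v 1)) :=
  InCone_thetaCyc_of_InCone_tri InCone_X11 InCone_v1 InCone_thetaTri_X11_X10 hp hq hs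

/-- Cycle with the marked vertices `X(1,1)`, `X(0,1)`. -/
theorem InCone_thetaCyc_X11_X01 {p q s : ℝ} (hp : 0 ≤ p) (hq : 0 ≤ q) (hs : 0 ≤ s) :
    InCone (thetaCyc p q s (v 1 * v 0) (v 0)) :=
  InCone_thetaCyc_of_InCone_tri InCone_X11 InCone_v0 InCone_thetaTri_X11_X01 hp hq hs

/-- Cycle with the marked vertices `X(1,1)`, `X(2,0)`. -/
theorem InCone_thetaCyc_X11_X20 {p q s : ℝ} (hp : 0 ≤ p) (hq : 0 ≤ q) (hs : 0 ≤ s) :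
    InCone (thetaCyc p q s (v 1 * v 0) (v 1 * v 1)) :=
  InCone_thetaCyc_of_InCone_tri InCone_X11 (InCone_v1.mul InCone_v1) InCone_thetaTri_X11_X20 hp hq hs

/-- Cycle with the marked vertices `X(1,1)`, `X(0,2)`. -/
theorem InCone_thetaCyc_X11_X02 {p q s : ℝ} (hp : 0 ≤ p) (hq : 0 ≤ q) (hs : 0 ≤ s) :
    InCone (thetaCyc p q s (v 1 * v 0) (v 0 * v 0)) :=
  InCone_thetaCyc_of_InCone_tri InCone_X11 (InCone_v0.mul InCone_v0) InCone_thetaTri_X11_X02 hp hq hs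

/-- Cycle with the marked vertices `X(2,0)`, `X(0,1)`. -/
theorem InCone_thetaCyc_X20_X01 {p q s : ℝ} (hp : 0 ≤ p) (hq : 0 ≤ q) (hs : 0 ≤ s) :
    InCone (thetaCyc p q s (v 1 * v 1) (v 0)) :=
  InCone_thetaCyc_of_InCone_tri (InCone_v1.mul InCone_v1) InCone_v0 InCone_thetaTri_X20_X01 hp hq hs

/-- Cycle with the marked vertices `X(1,0)`, `X(0,2)`. -/
theorem InCone_thetaCyc_X10_X02 {p q s : ℝ} (hp : 0 ≤ p) (hq : 0 ≤ q) (hs : 0 ≤ s) :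
    InCone (thetaCyc p q s (v 1) (v 0 * v 0)) :=
  InCone_thetaCyc_of_InCone_tri InCone_v1 (InCone_v0.mul InCone_v0) InCone_thetaTri_X10_X02 hp hq hs

/-- Cycle with the marked vertices `X(2,0)`, `X(0,2)`. -/
theorem InCone_thetaCyc_X20_X02 {p q s : ℝ} (hp : 0 ≤ p) (hq : 0 ≤ q) (hs : 0 ≤ s) :
    InCone (thetaCyc p q s (v 1 * v 1) (v 0 * v 0)) :=
  InCone_thetaCyc_of_InCone_tri (InCone_v1.mul InCone_v1) (InCone_v0.mul InCone_v0) InCone_thetaTri_X20_X02 hp hq hs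

end RelaxedTriangle

end PercRepro
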